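import Summits.AtomisticToContinuum.BoseEinsteinCondensation.Theorems.BECConjugateDominationDefs

/-!
# Sketch — crux-ideate r2 k4, crux `InfraredMinimumUncertainty` (stmt-AtomisticToContinuum-11784)

First-lemma signatures of the idea card `tilted-coherence-work-variance` of this seat (nothing is
asserted; every `def … : Prop` is a statement to be proved by a line, never used as a hypothesis):
the TILT FAMILY `μ_t ∝ Ψ(X)^{2(1-t)} Ψ(τ_r X)^{2t}`, the displacement WORK `δU_r = log Ψ − log Ψ∘τ_r`,
the thermodynamic-integration identity `−log g(r) = 2 ∫₀¹ min(t,1−t) Var_{μ_t}(δU_r) dt`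
(`TiltedCoherenceIdentity`, kinematic, every positive state), the BRIDGE POISSON IDENTITY
(`BridgePoissonIdentity`, the minimality-carrying first lemma: at `t = ½` the work solves
`−L_{1/2} δU_r = W∘τ_r − W` weakly), the `t`-resolved product `tiltedProduct` and the TRANSFER
`TiltedMinimumUncertainty` with its composition `TransferComposition` (TI identity + Fubini).
-/

noncomputable section

open MeasureTheory Filter Set
open scoped ENNReal NNReal Topology BigOperators

namespace Summit.AtomisticToContinuum.BoseEinsteinCondensation.Cruxes.InfraredMinimumUncertainty.TiltedCoherence

open Literature.MathematicalPhysics.QuantumManyBody.BoseGas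
open Summit.AtomisticToContinuum.BoseEinsteinCondensation.Cruxes.InfraredMinimumUncertainty.FisherGaussianDensityMode

variable {n : ℕ} {L : ℝ}

/-- Shift of the tagged particle (index `0`) by `r`: `τ_r X = (x₀ + r, x₁, …, x_n)`. -/
def shiftFirst (r : Space) (X : Config (n + 1)) : Config (n + 1) :=
  Function.update X 0 (X 0 + r)

/-- The displacement WORK `δU_r(X) = log Ψ(X) − log Ψ(τ_r X)` (`Ψ = e^{−U}` positive). -/
def work (Ψ : PeriodicTrialState (n + 1) L) (r : Space) (X : Config (n + 1)) : ℝ :=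
  Real.log ‖Ψ.ψ X‖ - Real.log ‖Ψ.ψ (shiftFirst r X)‖

/-- The tilt weight `Ψ(X)^{2(1−t)} Ψ(τ_r X)^{2t}` of the geometric interpolation
`Φ_t = Ψ^{1−t}(Ψ∘τ_r)^t` (unnormalised density of `μ_t`). -/
def tiltWeight (Ψ : PeriodicTrialState (n + 1) L) (t : ℝ) (r : Space) (X : Config (n + 1)) : ℝ :=
  ‖Ψ.ψ X‖ ^ (2 * (1 - t)) * ‖Ψ.ψ (shiftFirst r X)‖ ^ (2 * t)

/-- `φ_r(t) = ∫_{cell^N} Ψ^{2(1−t)} (Ψ∘τ_r)^{2t}` (`φ_r(0) = φ_r(1) = 1`, `φ_r(½) = g(r)`). -/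
def tiltNorm (Ψ : PeriodicTrialState (n + 1) L) (t : ℝ) (r : Space) : ℝ :=
  ∫ X in cellN (n + 1) L, tiltWeight Ψ t r X

/-- `E_{μ_t}[δU_r]`. -/
def tiltMean (Ψ : PeriodicTrialState (n + 1) L) (t : ℝ) (r : Space) : ℝ :=
  (tiltNorm Ψ t r)⁻¹ * ∫ X in cellN (n + 1) L, tiltWeight Ψ t r X * work Ψ r X

/-- `Var_{μ_t}(δU_r)` — the work variance under the tilted state. -/
def tiltVar (Ψ : PeriodicTrialState (n + 1) L) (t : ℝ) (r : Space) : ℝ :=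
  (tiltNorm Ψ t r)⁻¹ * ∫ X in cellN (n + 1) L, tiltWeight Ψ t r X * (work Ψ r X - tiltMean Ψ t r) ^ 2

/-- **Thermodynamic-integration identity for the coherence** (first lemma of card
`tilted-coherence-work-variance`, KINEMATIC — every positive `C¹` periodic state, no minimality):
`−log g(r) = 2 ∫₀¹ min(t, 1−t) · Var_{μ_t}(δU_r) dt`, because `ψ(t) = log φ_r(t)` is convex with
`ψ'' = 4 Var_{μ_t}(δU_r)`, `ψ(0) = 0` (normalisation), `ψ(1) = 0` (normalisation of the shifted state,
periodicity) and `ψ(½) = log g(r)`. -/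
def TiltedCoherenceIdentity : Prop :=
  ∀ (n : ℕ) (L : ℝ), 0 < L → ∀ Ψ : PeriodicTrialState (n + 1) L, (∀ X, Ψ.ψ X ≠ 0) →
    ∀ r : Space,
      -Real.log (coherence n L Ψ r) = 2 * ∫ t in (0 : ℝ)..1, min t (1 - t) * tiltVar Ψ t r

/-- **Bridge Poisson identity** (first lemma carrying MINIMALITY, card
`tilted-coherence-work-variance`): for a positive minimiser `Ψ` of the smooth class, at the bridge
point `t = ½` the work solves, weakly against every `C¹` periodic test function `η` (no symmetry
required: the bosonic ground state is the absolute ground state), the Poisson equation of the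
bridge generator `L_{1/2} = Δ − ∇(U + U∘τ_r)·∇` with the EXPLICIT divergence-form source
`W∘τ_r − W`:
`∫ ∇η · ∇(δU_r) Ψ (Ψ∘τ_r) dX = ∫ η · (W∘τ_r − W) · Ψ (Ψ∘τ_r) dX`.
(Pointwise: `(H − E₀)Φ_t = [t(W − W∘τ_r) + t(1−t)|∇δU_r|²] Φ_t`; at `t = ½` the gradient term of
the generator identity `L_t δU_r = (W − W∘τ_r) + (1−2t)|∇δU_r|²` drops.) -/
def BridgePoissonIdentity : Prop :=
  ∀ v : ℝ → ℝ≥0∞, InSmoothClass v → ∀ (n : ℕ) (L : ℝ), 0 < L →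
    ∀ Ψ : PeriodicTrialState (n + 1) L, IsPositiveMinimiser v Ψ → ContDiff ℝ 2 Ψ.ψ →
    ∀ r : Space, ∀ η : Config (n + 1) → ℝ, ContDiff ℝ 1 η →
      (∀ (X : Config (n + 1)) (i : Fin (n + 1)) (k : Fin 3),
        η (X + Pi.single i (EuclideanSpace.single k L)) = η X) →
      (∫ X in cellN (n + 1) L,
        (∑ i : Fin (n + 1), ∑ k : Fin 3,
          fderiv ℝ η X (Pi.single i (EuclideanSpace.single k (1 : ℝ))) *
            fderiv ℝ (work Ψ r) X (Pi.single i (EuclideanSpace.single k (1 : ℝ)))) *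
          (‖Ψ.ψ X‖ * ‖Ψ.ψ (shiftFirst r X)‖)) =
      ∫ X in cellN (n + 1) L,
        η X * ((periodicInteraction v L (shiftFirst r X)).toReal - (periodicInteraction v L X).toReal) *
          (‖Ψ.ψ X‖ * ‖Ψ.ψ (shiftFirst r X)‖)

/-- The `t`-resolved minimum-uncertainty product: `Π_t(m) := −N · S_m · V̂_t(m) / 2`, where
`V̂_t(m) = Re ĉ_m[r ↦ Var_{μ_t^{(r)}}(δU_r)]` is the cell Fourier coefficient of the work-variance
PROFILE (so that `Π_m = ∫₀¹ 4 min(t,1−t) Π_t(m) dt` by `TiltedCoherenceIdentity`). -/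
def tiltedProduct (n : ℕ) (L : ℝ) (Ψ : PeriodicTrialState (n + 1) L) (t : ℝ) (m : Fin 3 → ℤ) : ℝ :=
  -(((n : ℝ) + 1) * structureFactor n L Ψ m *
      (cellFourierCoeff L (fun r : Space => ((tiltVar Ψ t r : ℝ) : ℂ)) m).re) / 2

/-- **Tilted minimum uncertainty** (the TRANSFER `C⁺` of the card; strictly stronger than the
crux, which is its `4 min(t,1−t) dt`-average): for every smooth-class `v` there are `C ≥ 0`,
`ρ₀ > 0` such that for `0 < ρ < ρ₀`, eventually in `N = n+1`, every positive minimiser on the torus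
of side `(N/ρ)^{1/3}`, every `m ≠ 0` and EVERY tilt `t ∈ [0,1]`: `Π_t(m) ≤ C`. Toy census
(kit j016956, 10 exact Bose–Hubbard ground states, d = 1,2,3): `sup_{t,m} Π_t ≤ 1.12 · max_m Π_m`. -/
def TiltedMinimumUncertainty : Prop :=
  ∀ v : ℝ → ℝ≥0∞, InSmoothClass v → ∃ C : ℝ, 0 ≤ C ∧ ∃ ρ₀ : ℝ, 0 < ρ₀ ∧ ∀ ρ : ℝ, 0 < ρ → ρ < ρ₀ →
    ∀ᶠ n : ℕ in atTop, ∀ Ψ : PeriodicTrialState (n + 1) (sideLength ρ (n + 1)),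
      IsPositiveMinimiser v Ψ → ∀ m : Fin 3 → ℤ, m ≠ 0 → ∀ t ∈ Set.Icc (0 : ℝ) 1,
        tiltedProduct n (sideLength ρ (n + 1)) Ψ t m ≤ C

/-- The composition the line would certify (statement only here):
`TiltedCoherenceIdentity → TiltedMinimumUncertainty → InfraredMinimumUncertainty`
(Fubini in `(t, r)`, `∫₀¹ 4 min(t,1−t) dt = 1`, and `levyWeight = Re ĉ_m(log g)`). -/
def TransferComposition : Prop :=
  TiltedCoherenceIdentity → TiltedMinimumUncertainty →
    Summit.AtomisticToContinuum.BoseEinsteinCondensation.Theses.BECConjugateDomination.InfraredMinimumUncertainty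

end Summit.AtomisticToContinuum.BoseEinsteinCondensation.Cruxes.InfraredMinimumUncertainty.TiltedCoherence

end
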